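import Summits.ResolutionOfSingularities.ResolutionOfSingularities.Theorems.EquisingularLiftEquisingularLiftNatNoLevel
import HarnessLib

/-!
# [OURS] GENERAL-TAIL NEGATIVE THEOREM, SHARP CUBIC FORM: a surface double point `y₂² + y₂·A + B` with `A ∈ (y)²`, `B ∈ (y)⁴` — i.e. the cubic form of
# the equation is DIVISIBLE BY the tangent-cone variable (`c₃(y₀, y₁) ≡ 0`) — has NO finite blow-up depth in any blow-up tower (every field)
# (cruxes `Theses.EquisingularLift.EquisingularLiftNat` / `…NatThree` / `EquisingularLift`, stmt-ResolutionOfSingularities-20038 / -20148 / -15660)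

[OURS · leafhand-res-equisingularlift-12 g1, 2026-09-01; cell `pub/decomp-res`] AI-produced, weaker than expert review; NOT a statement of any manuscript;
nothing here proves resolution of singularities in positive characteristic.  DEF-FREE helper; no `sorry`; standard axioms; ZERO named hypotheses.

Sharpening of ✓ `towerLevel_none_origin_sq_add_pow_four` (`A = 0`): for a double point `f = x² + c₃(y,z) + x·q₂(x,y,z) + (order ≥ 4)` with double-plane
tangent cone `x²`, the `D/E` ladder starts from the binary cubic `c₃(y,z)`; when `c₃ ≡ 0` (every cubic monomial divisible by `x`) chart `1` of the blow-up
carries `T₂² + T₁T₂·A' + T₁²·B' ∈ (T₁, T₂)²` — singular along the line `T₁ = T₂ = 0` of the exceptional divisor — whatever `q₂` and the tail are, in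
every characteristic (no completing of squares needed).

* ★★★ `OneStep.towerLevel_none_origin_sq_add_X_mul` — `A ∈ (y)²`, `B ∈ (y)⁴` arbitrary ⟹ `∀ n, ¬ D n (Spec K[y₀,y₁,y₂]/(y₂² + (y₂A + B))) (origin)`.

Closes no registered stub.

References: [StacksProject, Tag 0804]; [Matsumura1987, Thm. 14.2]; [Lipman1969, §24]; through the cited tree files.
-/

set_option linter.dupNamespace false -- mandated namespace `Summit.<Summit>.<Problem>` of this single-conjunct summit

noncomputable section

open CategoryTheory CategoryTheory.Limits AlgebraicGeometry TopologicalSpace Topology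
open MvPolynomial
open Literature.AlgebraicGeometry.Resolution
open AlgebraicGeometry.Scheme.IdealSheafData

namespace Summit.ResolutionOfSingularities.ResolutionOfSingularities.Cruxes.EquisingularLiftNat.Sections

namespace OneStep

variable (K : Type) [Field K]

/-- ★★★ **DOUBLE POINTS WITH CUBIC FORM DIVISIBLE BY THE CONE VARIABLE HAVE NO BLOW-UP DEPTH**: for `A ∈ (y)²`, `B ∈ (y)⁴` and every blow-up tower `D`,
the origin of `Spec K[y₀,y₁,y₂]/(y₂² + (y₂A + B))` has no `D`-level. [OURS] [cite: StacksProject, Tag 0804] [cite: Matsumura1987, Thm. 14.2]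
[cite: Lipman1969, §24] -/
theorem towerLevel_none_origin_sq_add_X_mul (D : ℕ → ∀ Γ : Scheme.{0}, Γ → Prop)
    (hD0 : ∀ (Γ : Scheme.{0}) (y : Γ), IsClosed (({y} : Set Γ)) →
      (D 0 Γ y ↔ ∀ (hy : IsClosed (({y} : Set Γ))) (Z : Scheme.{0}) (τ : Z ⟶ Γ), IsBlowup τ (vanishingIdeal ⟨{y}, hy⟩) →
        ∀ z : Z, τ z = y → IsRegularLocalRing (Z.presheaf.stalk z)))
    (hDsucc : ∀ (d : ℕ) (Γ : Scheme.{0}) (y : Γ), IsClosed (({y} : Set Γ)) →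
      (D (d + 1) Γ y ↔ ∀ (hy : IsClosed (({y} : Set Γ))) (Z : Scheme.{0}) (τ : Z ⟶ Γ), IsBlowup τ (vanishingIdeal ⟨{y}, hy⟩) →
        ∃ S' : Finset Z, (∀ z : Z, τ z = y → z ∉ S' → IsRegularLocalRing (Z.presheaf.stalk z)) ∧
          ∀ z ∈ S', τ z = y ∧ IsClosed (({z} : Set Z)) ∧ ∃ d' ≤ d, D d' Z z))
    (A B : MvPolynomial (Fin 3) K) (hA : A ∈ Ideal.span (Set.range (X : Fin 3 → MvPolynomial (Fin 3) K)) ^ 2)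
    (hB : B ∈ Ideal.span (Set.range (X : Fin 3 → MvPolynomial (Fin 3) K)) ^ 4)
    (y₀ : Spec (CommRingCat.of (MvPolynomial (Fin 3) K ⧸ Ideal.span {(X 2 ^ 2 : MvPolynomial (Fin 3) K) + (X 2 * A + B)})))
    (hy₀ : y₀.asIdeal = Ideal.map (Ideal.Quotient.mk (Ideal.span {(X 2 ^ 2 : MvPolynomial (Fin 3) K) + (X 2 * A + B)}))
      (Ideal.span (Set.range (X : Fin 3 → MvPolynomial (Fin 3) K)))) (n : ℕ) :
    ¬ D n (Spec (CommRingCat.of (MvPolynomial (Fin 3) K ⧸ Ideal.span {(X 2 ^ 2 : MvPolynomial (Fin 3) K) + (X 2 * A + B)}))) y₀ := by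
  classical
  set I : Ideal (MvPolynomial (Fin 3) K) := Ideal.span (Set.range (X : Fin 3 → MvPolynomial (Fin 3) K)) with hI
  have hΦ : (X 2 ^ 2 : MvPolynomial (Fin 3) K).IsHomogeneous 2 := isHomogeneous_X_pow (2 : Fin 3) 2
  have hΦ0 : (X 2 ^ 2 : MvPolynomial (Fin 3) K) ≠ 0 := pow_ne_zero _ (X_ne_zero 2)
  have hX2I : (X 2 : MvPolynomial (Fin 3) K) ∈ I := Ideal.subset_span (Set.mem_range_self (2 : Fin 3))
  have hΨ3 : X 2 * A + B ∈ I ^ (2 + 1) := by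
    refine Ideal.add_mem _ ?_ (Ideal.pow_le_pow_right (by norm_num) hB)
    rw [pow_succ']
    exact Ideal.mul_mem_mul hX2I hA
  -- chart `1`: `A(T₁T₀, T₁, T₁T₂) = T₁²·A'`, `B(…) = T₁⁴·B'`, strict transform `T₂² + T₁T₂A' + T₁²B'`
  obtain ⟨A', hA'⟩ := FirstOrderPoint.exists_aeval_subst_eq_pow_mul K 1 hA
  obtain ⟨B', hB'⟩ := FirstOrderPoint.exists_aeval_subst_eq_pow_mul K 1 hB
  have hG : aeval (fun j => X 1 * Function.update (X : Fin 3 → MvPolynomial (Fin 3) K) 1 1 j) ((X 2 ^ 2 : MvPolynomial (Fin 3) K) + (X 2 * A + B)) =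
      X 1 ^ 2 * (X 2 ^ 2 + (X 1 * X 2 * A' + X 1 ^ 2 * B')) := by
    rw [map_add, map_add, map_mul, hA', hB', map_pow, aeval_X, Function.update_of_ne (by decide : (2 : Fin 3) ≠ 1)]
    ring
  let P : Ideal (MvPolynomial (Fin 3) K) := Ideal.span (X '' ({1, 2} : Set (Fin 3)))
  haveI hP : P.IsPrime := Literature.RingTheory.MvPolynomial.isPrime_span_X_image _
  have hX1 : (X 1 : MvPolynomial (Fin 3) K) ∈ P := Literature.RingTheory.MvPolynomial.X_mem_span_X_image_iff.mpr (by simp)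
  have hX2 : (X 2 : MvPolynomial (Fin 3) K) ∈ P := Literature.RingTheory.MvPolynomial.X_mem_span_X_image_iff.mpr (by simp)
  have hX0 : (X 0 : MvPolynomial (Fin 3) K) ∉ P := fun h =>
    absurd (Literature.RingTheory.MvPolynomial.X_mem_span_X_image_iff.mp h) (by simp)
  have hPmax : ¬ P.IsMaximal := by
    intro hM
    let Q : Ideal (MvPolynomial (Fin 3) K) := Ideal.span (X '' (Set.univ : Set (Fin 3)))
    haveI hQ : Q.IsPrime := Literature.RingTheory.MvPolynomial.isPrime_span_X_image _
    have hPQ : P ≤ Q := Ideal.span_mono (Set.image_mono (Set.subset_univ _))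
    have hEq : P = Q := hM.eq_of_le hQ.ne_top hPQ
    exact hX0 (hEq ▸ Literature.RingTheory.MvPolynomial.X_mem_span_X_image_iff.mpr (Set.mem_univ _))
  have hGP : (X 2 ^ 2 + (X 1 * X 2 * A' + X 1 ^ 2 * B') : MvPolynomial (Fin 3) K) ∈ P ^ 2 := by
    refine Ideal.add_mem _ (Ideal.pow_mem_pow hX2 2) (Ideal.add_mem _ (Ideal.mul_mem_right _ _ ?_) (Ideal.mul_mem_right _ _ (Ideal.pow_mem_pow hX1 2)))
    rw [pow_two]
    exact Ideal.mul_mem_mul hX1 hX2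
  have hG0 : (X 2 ^ 2 + (X 1 * X 2 * A' + X 1 ^ 2 * B') : MvPolynomial (Fin 3) K) ≠ 0 := by
    intro h
    have h1 := congrArg (eval (Pi.single (2 : Fin 3) (1 : K))) h
    simp at h1
  exact towerLevel_none_origin_of_mem_sq K D hD0 hDsucc (X 2 ^ 2) (X 2 * A + B) (by norm_num) hΦ hΦ0 hΨ3 1 _ hG0 hG P hPmax hX1 hGP y₀ hy₀ n

end OneStep

end Summit.ResolutionOfSingularities.ResolutionOfSingularities.Cruxes.EquisingularLiftNat.Sections

end
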